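import Mathlib.Combinatorics.SimpleGraph.Walk.Basic
import Mathlib.Combinatorics.SimpleGraph.Paths
import Mathlib.Data.Fintype.Pi
import Mathlib.Data.Fintype.BigOperators
import Mathlib.Algebra.Order.BigOperators.Group.Finset
import Mathlib.Analysis.SpecialFunctions.Pow.Real
import HarnessLib

/-!
# Self-avoiding walks as vertex lists: finiteness, weighted sums, splicing

Bookkeeping for Peierls-type "energy–entropy" arguments on self-avoiding walks (the surgery of
H. Duminil-Copin, G. Kozma, A. Yadin, *Supercritical self-avoiding walks are space-filling*,
Ann. IHP Probab. Stat. 50 (2014), §3: a walk is modified locally by inserting an excursion, and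
the modified walks are counted against the partition function). A self-avoiding walk of a graph
`G` confined to a finite vertex set `D` is recorded by its list of vertices (`IsSAWList G D l`:
non-empty, consecutive vertices adjacent, no repetition, all vertices in `D`); such lists form the
finite set `domSawLists G D u v` (given endpoints), with partition function
`listPartition G D u v x = Σ_l x^{|l|-1}`. We prove the membership characterisations, the
reversal symmetry, the **splice lemma** `IsSAWList.splice` (replacing the stretch strictly
between two vertices `s₁, s₂` of a walk by a fresh self-avoiding stretch keeps a self-avoiding
walk), the length bookkeeping, the `takeWhile` decoding lemmas used to invert such surgeries,
the passage from Mathlib walks (`SimpleGraph.Walk.support`, `SimpleGraph.Walk.ofSupport`), and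
the weighted counting lemma `sum_le_of_injOn_sideData` (a map into the walks that is injective
given a finite piece of side information loses at most the number of side values).

Mathlib: `List.IsChain`, `List.Nodup`, `Fintype.piFinset`, `List.ofFn`, `SimpleGraph.Walk.ofSupport`.
-/

open Finset

namespace Literature.Probability.RandomPlanarGeometry.SAW

variable {V : Type*}

/-! ### Lists confined to a finite set -/

section Lists

variable [DecidableEq V]

/-- All lists of length at most `N` with entries in the finite set `D`. [folklore] -/
def listsIn (D : Finset V) (N : ℕ) : Finset (List V) :=
  (range (N + 1)).biUnion fun n => (Fintype.piFinset fun _ : Fin n => D).image List.ofFn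

/-- Membership in `listsIn`: entries in `D` and length at most `N`. [folklore] -/
theorem mem_listsIn {D : Finset V} {N : ℕ} {l : List V} :
    l ∈ listsIn D N ↔ (∀ w ∈ l, w ∈ D) ∧ l.length ≤ N := by
  simp only [listsIn, mem_biUnion, mem_range, mem_image, Fintype.mem_piFinset]
  constructor
  · rintro ⟨n, hn, f, hf, rfl⟩
    refine ⟨fun w hw => ?_, by simp; omega⟩
    obtain ⟨i, rfl⟩ := (List.mem_ofFn' f w).1 hw
    exact hf i
  · rintro ⟨hD, hlen⟩
    exact ⟨l.length, by omega, fun i => l[i], fun i => hD _ (List.getElem_mem _), by simp⟩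

end Lists

/-! ### Self-avoiding lists -/

variable (G : SimpleGraph V)

/-- A **self-avoiding walk recorded by its vertex list**: a non-empty list of vertices of `D`,
consecutive ones adjacent in `G`, without repetition. [cite: MadrasSlade1993, Definition 1.1.1] -/
structure IsSAWList (D : Finset V) (l : List V) : Prop where
  /-- a walk has at least one vertex -/
  ne_nil : l ≠ []
  /-- consecutive vertices are adjacent -/
  isChain : l.IsChain G.Adj
  /-- no vertex is visited twice -/
  nodup : l.Nodup
  /-- the walk stays in `D` -/
  subset : ∀ w ∈ l, w ∈ D

/-- Being a self-avoiding list is decidable. [folklore] -/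
instance IsSAWList.instDecidable [DecidableEq V] [DecidableRel G.Adj] (D : Finset V) (l : List V) :
    Decidable (IsSAWList G D l) :=
  decidable_of_iff (l ≠ [] ∧ l.IsChain G.Adj ∧ l.Nodup ∧ ∀ w ∈ l, w ∈ D)
    ⟨fun h => ⟨h.1, h.2.1, h.2.2.1, h.2.2.2⟩, fun h => ⟨h.1, h.2, h.3, h.4⟩⟩

variable {G}

/-- A self-avoiding list in `D` is no longer than `#D`. [folklore] -/
theorem IsSAWList.length_le_card [DecidableEq V] {D : Finset V} {l : List V} (h : IsSAWList G D l) :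
    l.length ≤ D.card := by
  rw [← List.toFinset_card_of_nodup h.nodup]
  exact card_le_card fun w hw => h.subset w (List.mem_toFinset.1 hw)

/-- Monotonicity in the confining set. [folklore] -/
theorem IsSAWList.mono {D D' : Finset V} (hDD' : D ⊆ D') {l : List V} (h : IsSAWList G D l) :
    IsSAWList G D' l :=
  ⟨h.ne_nil, h.isChain, h.nodup, fun w hw => hDD' (h.subset w hw)⟩

/-- Reversal of a self-avoiding list. [folklore] -/
theorem IsSAWList.reverse {D : Finset V} {l : List V} (h : IsSAWList G D l) :
    IsSAWList G D l.reverse :=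
  ⟨by simpa using h.ne_nil, List.isChain_reverse.2 (h.isChain.imp fun _ _ hab => hab.symm),
    List.nodup_reverse.2 h.nodup, fun w hw => h.subset w (List.mem_reverse.1 hw)⟩

/-- A contiguous piece of a self-avoiding list is self-avoiding (if non-empty). [folklore] -/
theorem IsSAWList.infix {D : Finset V} {l l' : List V} (h : IsSAWList G D l) (hl' : l' <:+: l)
    (hne : l' ≠ []) : IsSAWList G D l' :=
  ⟨hne, h.isChain.infix hl', hl'.sublist.nodup h.nodup, fun w hw => h.subset w (hl'.subset hw)⟩

variable (G)

section Finite

variable [DecidableEq V] [DecidableRel G.Adj]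

/-- The finite set of self-avoiding lists in `D` from `u` to `v` (first vertex `u`, last
vertex `v`). [cite: MadrasSlade1993, Definition 1.1.1] -/
def domSawLists (D : Finset V) (u v : V) : Finset (List V) :=
  (listsIn D D.card).filter fun l => IsSAWList G D l ∧ l.head? = some u ∧ l.getLast? = some v

variable {G}

/-- Membership in `domSawLists`. [folklore] -/
theorem mem_domSawLists {D : Finset V} {u v : V} {l : List V} :
    l ∈ domSawLists G D u v ↔ IsSAWList G D l ∧ l.head? = some u ∧ l.getLast? = some v := by
  rw [domSawLists, mem_filter, mem_listsIn]
  constructor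
  · exact fun h => h.2
  · exact fun h => ⟨⟨h.1.subset, h.1.length_le_card⟩, h⟩

/-- Reversal exchanges the endpoints. [folklore] -/
theorem reverse_mem_domSawLists {D : Finset V} {u v : V} {l : List V} (h : l ∈ domSawLists G D u v) :
    l.reverse ∈ domSawLists G D v u := by
  rw [mem_domSawLists] at h ⊢
  refine ⟨h.1.reverse, ?_, ?_⟩
  · rw [List.head?_reverse]; exact h.2.2
  · rw [List.getLast?_reverse]; exact h.2.1

/-- The endpoints of a member of `domSawLists G D u v` lie in `D`. [folklore] -/
theorem mem_of_mem_domSawLists {D : Finset V} {u v : V} {l : List V} (h : l ∈ domSawLists G D u v) :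
    u ∈ D ∧ v ∈ D := by
  rw [mem_domSawLists] at h
  exact ⟨h.1.subset u (List.mem_of_mem_head? h.2.1), h.1.subset v (List.mem_of_getLast? h.2.2)⟩

/-! ### Partition functions -/

variable (G)

/-- The partition function with fugacity `x` of self-avoiding lists in `D` from `u` to `v`:
`Σ_l x^{|l| - 1}` (`|l| - 1` is the number of steps). [cite: DuminilCopinKozmaYadin2014, §1 (definition of Z_{(Ω,a,b)}(x))] -/
noncomputable def listPartition (D : Finset V) (u v : V) (x : ℝ) : ℝ :=
  ∑ l ∈ domSawLists G D u v, x ^ (l.length - 1)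

variable {G}

/-- The partition function is non-negative for `x ≥ 0`. [folklore] -/
theorem listPartition_nonneg (D : Finset V) (u v : V) {x : ℝ} (hx : 0 ≤ x) :
    0 ≤ listPartition G D u v x :=
  sum_nonneg fun _ _ => pow_nonneg hx _

/-- The partition function is symmetric in the endpoints (reverse the walks).
[cite: DuminilCopinKozmaYadin2014, §1 (definition of Z_{(Ω,a,b)}(x))] -/
theorem listPartition_comm (D : Finset V) (u v : V) (x : ℝ) :
    listPartition G D u v x = listPartition G D v u x := by
  unfold listPartition
  refine Finset.sum_nbij' List.reverse List.reverse (fun l hl => reverse_mem_domSawLists hl)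
    (fun l hl => reverse_mem_domSawLists hl) (fun l _ => List.reverse_reverse l)
    (fun l _ => List.reverse_reverse l) (fun l _ => by rw [List.length_reverse])

/-- A single member bounds the partition function from below (`x ≥ 0`). [folklore] -/
theorem pow_le_listPartition {D : Finset V} {u v : V} {x : ℝ} (hx : 0 ≤ x) {l : List V}
    (hl : l ∈ domSawLists G D u v) : x ^ (l.length - 1) ≤ listPartition G D u v x :=
  single_le_sum (f := fun l : List V => x ^ (l.length - 1)) (fun _ _ => pow_nonneg hx _) hl

end Finite

variable {G}

/-! ### The splice lemma -/

/-- **Splice lemma.** In a self-avoiding list `pre ++ s₁ :: mid ++ s₂ :: post` replace the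
stretch `mid` strictly between `s₁` and `s₂` by a list `ins` of fresh vertices of `D`, without
repetition, such that `s₁ :: ins ++ [s₂]` is a chain: the result is a self-avoiding list (the
local surgery `γ ↦ γ'` of an energy–entropy argument). [cite: DuminilCopinKozmaYadin2014, §3 (proof of Proposition 7)] -/
theorem IsSAWList.splice {D : Finset V} {pre mid post ins : List V} {s₁ s₂ : V}
    (h : IsSAWList G D (pre ++ s₁ :: mid ++ s₂ :: post))
    (hchain : (s₁ :: ins ++ [s₂]).IsChain G.Adj) (hnodup : ins.Nodup)
    (hfresh : ∀ w ∈ ins, w ∉ pre ++ s₁ :: mid ++ s₂ :: post) (hD : ∀ w ∈ ins, w ∈ D) :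
    IsSAWList G D (pre ++ s₁ :: ins ++ s₂ :: post) := by
  refine ⟨by simp, ?_, ?_, ?_⟩
  · -- chain: `pre ++ [s₁]`, then `s₁ :: ins ++ [s₂]`, then `s₂ :: post`
    have h1 : (pre ++ [s₁]).IsChain G.Adj :=
      h.isChain.prefix ⟨mid ++ s₂ :: post, by simp⟩
    have h3 : (s₂ :: post).IsChain G.Adj := h.isChain.suffix ⟨pre ++ s₁ :: mid, by simp⟩
    have h12 : (pre ++ [s₁] ++ (ins ++ [s₂])).IsChain G.Adj :=
      List.IsChain.append_overlap (l₂ := [s₁]) h1 (by simpa using hchain) (by simp)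
    have h123 : (pre ++ [s₁] ++ ins ++ [s₂] ++ post).IsChain G.Adj := by
      have := List.IsChain.append_overlap (l₁ := pre ++ [s₁] ++ ins) (l₂ := [s₂]) (l₃ := post)
        (by simpa [List.append_assoc] using h12) (by simpa using h3) (by simp)
      simpa [List.append_assoc] using this
    simpa [List.append_assoc] using h123
  · -- no repetition
    have hnd := h.nodup
    rw [show pre ++ s₁ :: mid ++ s₂ :: post = (pre ++ [s₁]) ++ mid ++ (s₂ :: post) by simp] at hnd
    rw [show pre ++ s₁ :: ins ++ s₂ :: post = (pre ++ [s₁]) ++ ins ++ (s₂ :: post) by simp]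
    rw [List.nodup_append] at hnd ⊢
    obtain ⟨h12, h3, hdis⟩ := hnd
    rw [List.nodup_append] at h12 ⊢
    obtain ⟨h1, -, -⟩ := h12
    refine ⟨⟨h1, hnodup, fun a ha b hb => ?_⟩, h3, fun a ha b hb => ?_⟩
    · rintro rfl
      exact hfresh a hb (by simp_all)
    · rw [List.mem_append] at ha
      rcases ha with ha | ha
      · exact hdis a (List.mem_append_left _ ha) b hb
      · rintro rfl
        exact hfresh a ha (by simp_all)
  · intro w hw
    simp only [List.mem_append, List.mem_cons] at hw
    rcases hw with (hw | rfl | hw) | rfl | hw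
    · exact h.subset w (by simp [hw])
    · exact h.subset _ (by simp)
    · exact hD w hw
    · exact h.subset _ (by simp)
    · exact h.subset w (by simp [hw])

/-- Endpoints are unchanged by splicing. [folklore] -/
theorem head?_splice (pre mid ins post : List V) (s₁ s₂ : V) :
    (pre ++ s₁ :: ins ++ s₂ :: post).head? = (pre ++ s₁ :: mid ++ s₂ :: post).head? := by
  cases pre <;> simp

/-- Endpoints are unchanged by splicing. [folklore] -/
theorem getLast?_splice (pre mid ins post : List V) (s₁ s₂ : V) :
    (pre ++ s₁ :: ins ++ s₂ :: post).getLast? = (pre ++ s₁ :: mid ++ s₂ :: post).getLast? := by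
  rw [show pre ++ s₁ :: ins ++ s₂ :: post = (pre ++ s₁ :: ins) ++ (s₂ :: post) by simp,
    show pre ++ s₁ :: mid ++ s₂ :: post = (pre ++ s₁ :: mid) ++ (s₂ :: post) by simp,
    List.getLast?_append_of_ne_nil _ (List.cons_ne_nil _ _),
    List.getLast?_append_of_ne_nil _ (List.cons_ne_nil _ _)]

/-- Length bookkeeping of a splice. [folklore] -/
theorem length_splice (pre mid ins post : List V) (s₁ s₂ : V) :
    (pre ++ s₁ :: ins ++ s₂ :: post).length + mid.length =
      (pre ++ s₁ :: mid ++ s₂ :: post).length + ins.length := by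
  simp only [List.length_append, List.length_cons]
  omega

/-- Spliced lists with the same endpoints: membership in `domSawLists`. [cite: DuminilCopinKozmaYadin2014, §3 (proof of Proposition 7)] -/
theorem splice_mem_domSawLists [DecidableEq V] [DecidableRel G.Adj] {D : Finset V} {u v : V} {pre mid post ins : List V} {s₁ s₂ : V}
    (h : pre ++ s₁ :: mid ++ s₂ :: post ∈ domSawLists G D u v)
    (hchain : (s₁ :: ins ++ [s₂]).IsChain G.Adj) (hnodup : ins.Nodup)
    (hfresh : ∀ w ∈ ins, w ∉ pre ++ s₁ :: mid ++ s₂ :: post) (hD : ∀ w ∈ ins, w ∈ D) :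
    pre ++ s₁ :: ins ++ s₂ :: post ∈ domSawLists G D u v := by
  rw [mem_domSawLists] at h ⊢
  exact ⟨h.1.splice hchain hnodup hfresh hD, (head?_splice pre mid ins post s₁ s₂).trans h.2.1,
    (getLast?_splice pre mid ins post s₁ s₂).trans h.2.2⟩

/-! ### Decoding spliced lists -/

/-- If `A` avoids a predicate and `B` starts with an element satisfying it, `A` is recovered
from `A ++ B` as the longest prefix avoiding the predicate. [folklore] -/
theorem takeWhile_eq_of_append {p : V → Bool} {A B : List V} (hA : ∀ a ∈ A, p a = false)
    (hB : ∀ b ∈ B.head?, p b = true) : (A ++ B).takeWhile (fun w => !p w) = A := by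
  rw [List.takeWhile_append_of_pos (by simpa using hA)]
  cases B with
  | nil => simp
  | cons b B => simp [hB b rfl]

/-- Cancellation for decodings: `A ++ B = A' ++ B'` with `A, A'` avoiding a predicate that the
heads of `B, B'` satisfy forces `A = A'` and `B = B'`. [folklore] -/
theorem append_inj_of_head {p : V → Bool} {A B A' B' : List V} (hA : ∀ a ∈ A, p a = false)
    (hB : ∀ b ∈ B.head?, p b = true) (hA' : ∀ a ∈ A', p a = false)
    (hB' : ∀ b ∈ B'.head?, p b = true) (h : A ++ B = A' ++ B') : A = A' ∧ B = B' := by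
  have hAA' : A = A' := by
    rw [← takeWhile_eq_of_append hA hB, h, takeWhile_eq_of_append hA' hB']
  subst hAA'
  exact ⟨rfl, List.append_cancel_left h⟩

/-! ### Consecutive pairs in lists without repetition -/

section Consecutive

variable [DecidableEq V]

/-- In a list without repetition, the prefix before an element is determined. [folklore] -/
theorem prefix_unique_of_nodup {l s t s' t' : List V} {g : V} (hl : l.Nodup)
    (h : l = s ++ g :: t) (h' : l = s' ++ g :: t') : s = s' ∧ t = t' := by
  have key := append_inj_of_head (p := fun w => decide (w = g)) (A := s) (B := g :: t) (A' := s')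
    (B' := g :: t') ?_ (by simp) ?_ (by simp) (h.symm.trans h')
  · exact ⟨key.1, List.cons_injective key.2⟩
  · intro a ha
    rw [h, List.nodup_append] at hl
    simpa using fun hag => hl.2.2 a ha g (by simp) hag
  · intro a ha
    rw [h', List.nodup_append] at hl
    simpa using fun hag => hl.2.2 a ha g (by simp) hag

/-- The predecessor of an element of a list without repetition is unique. [folklore] -/
theorem eq_of_infix_pair_left {l : List V} {a a' g : V} (hl : l.Nodup) (h : [a, g] <:+: l)
    (h' : [a', g] <:+: l) : a = a' := by
  obtain ⟨s, t, hst⟩ := h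
  obtain ⟨s', t', hst'⟩ := h'
  have e1 : l = (s ++ [a]) ++ g :: t := by rw [← hst]; simp
  have e2 : l = (s' ++ [a']) ++ g :: t' := by rw [← hst']; simp
  have := (prefix_unique_of_nodup hl e1 e2).1
  exact List.append_inj_right' this rfl |> List.singleton_injective

/-- The successor of an element of a list without repetition is unique. [folklore] -/
theorem eq_of_infix_pair_right {l : List V} {b b' g : V} (hl : l.Nodup) (h : [g, b] <:+: l)
    (h' : [g, b'] <:+: l) : b = b' := by
  obtain ⟨s, t, hst⟩ := h
  obtain ⟨s', t', hst'⟩ := h'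
  have e1 : l = s ++ g :: (b :: t) := by rw [← hst]; simp
  have e2 : l = s' ++ g :: (b' :: t') := by rw [← hst']; simp
  have := (prefix_unique_of_nodup hl e1 e2).2
  exact List.head_eq_of_cons_eq this

/-- A predecessor and a successor combine to a consecutive triple. [folklore] -/
theorem infix_triple_of_pairs {l : List V} {a g b : V} (hl : l.Nodup) (h : [a, g] <:+: l)
    (h' : [g, b] <:+: l) : [a, g, b] <:+: l := by
  obtain ⟨s, t, hst⟩ := h
  obtain ⟨s', t', hst'⟩ := h'
  have e1 : l = (s ++ [a]) ++ g :: t := by rw [← hst]; simp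
  have e2 : l = s' ++ g :: (b :: t') := by rw [← hst']; simp
  obtain ⟨-, rfl⟩ := prefix_unique_of_nodup hl e1 e2
  exact ⟨s, t', by rw [e1]; simp⟩

/-- An element with a predecessor is not the head. [folklore] -/
theorem ne_head_of_infix_pair {l : List V} {a g : V} (hl : l.Nodup) (h : [a, g] <:+: l)
    (hne : l ≠ []) : g ≠ l.head hne := by
  obtain ⟨s, t, hst⟩ := h
  intro hg
  have e1 : l = (s ++ [a]) ++ g :: t := by rw [← hst]; simp
  have e2 : l = [] ++ g :: l.tail := by rw [hg]; exact (List.cons_head_tail hne).symm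
  have := (prefix_unique_of_nodup hl e1 e2).1
  simp at this

/-- An element with a successor is not the last one. [folklore] -/
theorem ne_getLast_of_infix_pair {l : List V} {g b : V} (hl : l.Nodup) (h : [g, b] <:+: l)
    (hne : l ≠ []) : g ≠ l.getLast hne := by
  have h' : [b, g] <:+: l.reverse := by
    rw [← List.reverse_infix]; simpa using h
  rw [List.getLast_eq_head_reverse]
  exact ne_head_of_infix_pair (List.nodup_reverse.2 hl) h' (by simpa using hne)

omit [DecidableEq V] in
/-- Every element other than the head has a predecessor. [folklore] -/
theorem exists_infix_pair_left {l : List V} {g : V} (hg : g ∈ l) (hne : l ≠ [])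
    (hh : g ≠ l.head hne) : ∃ a, [a, g] <:+: l := by
  obtain ⟨s, t, rfl⟩ := List.append_of_mem hg
  cases s using List.reverseRecOn with
  | nil => simp at hh
  | append_singleton s a =>
    exact ⟨a, s, t, by simp⟩

omit [DecidableEq V] in
/-- Every element other than the last has a successor. [folklore] -/
theorem exists_infix_pair_right {l : List V} {g : V} (hg : g ∈ l) (hne : l ≠ [])
    (hh : g ≠ l.getLast hne) : ∃ b, [g, b] <:+: l := by
  have hg' : g ∈ l.reverse := List.mem_reverse.2 hg
  have hh' : g ≠ l.reverse.head (by simpa using hne) := by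
    rwa [← List.getLast_eq_head_reverse]
  obtain ⟨b, hb⟩ := exists_infix_pair_left hg' (by simpa using hne) hh'
  refine ⟨b, ?_⟩
  rw [← List.reverse_infix]
  simpa using hb

omit [DecidableEq V] in
/-- The two list-neighbours of an interior element of a list without repetition are distinct.
[folklore] -/
theorem ne_of_infix_triple {l : List V} {a g b : V} (hl : l.Nodup) (h : [a, g, b] <:+: l) :
    a ≠ b ∧ a ≠ g ∧ g ≠ b := by
  have hsub := h.sublist.nodup hl
  simp only [List.nodup_cons, List.mem_cons, not_or, List.not_mem_nil,
    not_false_eq_true, List.nodup_nil, and_true] at hsub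
  exact ⟨hsub.1.2, hsub.1.1, hsub.2⟩

end Consecutive

/-- Consecutive elements of a chain are related. [folklore] -/
theorem rel_of_infix_pair {R : V → V → Prop} {l : List V} {a b : V} (hl : l.IsChain R)
    (h : [a, b] <:+: l) : R a b :=
  List.isChain_pair.1 (hl.infix h)

/-! ### From and to Mathlib walks -/

/-- The support of a path with vertices in `D` is a self-avoiding list. [folklore] -/
theorem isSAWList_support {D : Finset V} {u v : V} (p : G.Walk u v) (hp : p.IsPath)
    (hD : ∀ w ∈ p.support, w ∈ D) : IsSAWList G D p.support :=
  ⟨p.support_ne_nil, p.isChain_adj_support, hp.support_nodup, hD⟩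

/-- The support of a path with vertices in `D` belongs to `domSawLists G D u v`. [folklore] -/
theorem support_mem_domSawLists [DecidableEq V] [DecidableRel G.Adj] {D : Finset V} {u v : V}
    (p : G.Walk u v) (hp : p.IsPath) (hD : ∀ w ∈ p.support, w ∈ D) :
    p.support ∈ domSawLists G D u v := by
  rw [mem_domSawLists]
  refine ⟨isSAWList_support p hp hD, ?_, ?_⟩
  · rw [List.head?_eq_some_head p.support_ne_nil, p.head_support]
  · rw [List.getLast?_eq_some_getLast p.support_ne_nil, p.getLast_support]

/-- The walk traced by a self-avoiding list is a path. [folklore] -/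
theorem isPath_ofSupport {D : Finset V} {l : List V} (h : IsSAWList G D l) :
    (SimpleGraph.Walk.ofSupport l h.ne_nil h.isChain).IsPath := by
  rw [SimpleGraph.Walk.isPath_def, SimpleGraph.Walk.support_ofSupport]
  exact h.nodup

/-- The head of a member of `domSawLists G D u v` is `u`. [folklore] -/
theorem head_eq_of_mem_domSawLists [DecidableEq V] [DecidableRel G.Adj] {D : Finset V} {u v : V} {l : List V} (h : l ∈ domSawLists G D u v)
    (hne : l ≠ []) : l.head hne = u := by
  rw [mem_domSawLists] at h
  rw [List.head?_eq_some_head hne, Option.some_inj] at h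
  exact h.2.1

/-- The last vertex of a member of `domSawLists G D u v` is `v`. [folklore] -/
theorem getLast_eq_of_mem_domSawLists [DecidableEq V] [DecidableRel G.Adj] {D : Finset V} {u v : V} {l : List V}
    (h : l ∈ domSawLists G D u v) (hne : l ≠ []) : l.getLast hne = v := by
  rw [mem_domSawLists] at h
  rw [List.getLast?_eq_some_getLast hne, Option.some_inj] at h
  exact h.2.2

/-! ### Weighted counting with side information -/

/-- **Weighted counting lemma.** If `f` maps a finite set `A` into `B`, is injective once a
piece of side information `g a` ranging over a finite type `σ` is known, and does not decrease
weights by more than a factor `K ≥ 0` (`wA a ≤ K · wB (f a)`, `wB ≥ 0`), then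
`Σ_A wA ≤ K · |σ| · Σ_B wB` — the multiplicity count of an energy–entropy surgery.
[cite: DuminilCopinKozmaYadin2014, §3 (proof of Proposition 7, "the transformation ... is at most 4^{100m}-to-one")] -/
theorem sum_le_of_injOn_sideData {α β σ : Type*} [DecidableEq β] [Fintype σ] [DecidableEq σ]
    (A : Finset α) (B : Finset β) (f : α → β) (g : α → σ) (wA : α → ℝ) (wB : β → ℝ) {K : ℝ}
    (hK : 0 ≤ K) (hwB : ∀ b ∈ B, 0 ≤ wB b) (hf : ∀ a ∈ A, f a ∈ B)
    (hinj : Set.InjOn (fun a => (g a, f a)) A) (hle : ∀ a ∈ A, wA a ≤ K * wB (f a)) :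
    ∑ a ∈ A, wA a ≤ K * Fintype.card σ * ∑ b ∈ B, wB b := by
  classical
  calc ∑ a ∈ A, wA a ≤ ∑ a ∈ A, K * wB (f a) := sum_le_sum hle
    _ = K * ∑ a ∈ A, wB (f a) := (mul_sum _ _ _).symm
    _ = K * ∑ s : σ, ∑ a ∈ A.filter (fun a => g a = s), wB (f a) := by
        rw [← sum_fiberwise_of_maps_to (g := g) (t := univ) (fun _ _ => mem_univ _)]
    _ ≤ K * ∑ _s : σ, ∑ b ∈ B, wB b := by
        refine mul_le_mul_of_nonneg_left (sum_le_sum fun s _ => ?_) hK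
        have hinj' : Set.InjOn f (A.filter fun a => g a = s) := by
          intro a ha a' ha' hfa
          simp only [coe_filter, Set.mem_setOf_eq] at ha ha'
          exact hinj ha.1 ha'.1 (by simp [ha.2, ha'.2, hfa])
        calc ∑ a ∈ A.filter (fun a => g a = s), wB (f a)
            = ∑ b ∈ (A.filter fun a => g a = s).image f, wB b := (sum_image hinj').symm
          _ ≤ ∑ b ∈ B, wB b :=
            sum_le_sum_of_subset_of_nonneg (fun b hb => by
              obtain ⟨a, ha, rfl⟩ := mem_image.1 hb
              exact hf a (mem_filter.1 ha).1) fun b hb _ => hwB b hb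
    _ = K * Fintype.card σ * ∑ b ∈ B, wB b := by
        rw [sum_const, card_univ, nsmul_eq_mul, mul_assoc]

end Literature.Probability.RandomPlanarGeometry.SAW
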